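import Literature.Barriers.QuantumAdvantage.NaturalProofs
import Literature.Barriers.PneNP.NaturalProofsProofs
import HarnessLib

/-!
# Barrier `NaturalProofs` (`QuantumAdvantage` catalogue): discharge and `HardPRGExist`-only readings

Sibling proof file (D-0014 append protocol; theorems only) of the D-0021 barrier entry
`Literature/Barriers/QuantumAdvantage/NaturalProofs.lean`. The entry fact is definitionally the
`PneNP` catalogue entry `Literature.Barriers.PneNP.NaturalProofs`
(`naturalProofs_iff_pneNP`), itself the tree fact
`Literature.Computability.Complexity.natural_proofs_barrier` (Razborov–Rudich 1997, Thm. 4.1;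
Arora–Barak 2009, Thm. 23.1: a `P/poly`-natural property useful against `P/poly` makes every
`P/poly`-computable pseudorandom generator family `2^{k^ε}`-easy infinitely often), which is a
theorem of the tree (`Literature.Barriers.PneNP.NaturalProofs_holds`,
`Literature/Barriers/PneNP/NaturalProofsProofs.lean`, from
`Literature.Computability.Complexity.natural_proofs_barrier_holds`: GGM tree + hybrid argument).
Discharged here: `NaturalProofs_holds`, and the entry's two no-go readings for route `CircuitLB`
with the barrier fact fed in, i.e. conditional on the pseudorandomness hypothesis
`Literature.Barriers.PneNP.HardPRGExist` only (`no_naturalProof_bqp_not_ppoly_of_hardPRG`,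
`no_naturalProof_fact_of_hardPRG`). Nothing here bears on the uniform summit `BQP ⊄ BPP` itself
(scope caveat of the entry).

## References

* A. A. Razborov, S. Rudich, *Natural proofs*, J. Comput. Syst. Sci. 55 (1997) 24–35
  [RazborovRudich1997], Thm. 4.1.
* S. Arora, B. Barak, *Computational Complexity: A Modern Approach*, CUP 2009 [AroraBarakCC2009],
  Thm. 23.1, §23.3, Ch. 23 introduction (PDF p. 586).
-/

noncomputable section

namespace Literature.Barriers.QuantumAdvantage

open _root_.Computability Literature.Computability.Complexity Literature.Computability.MetaComplexity Literature.Computability.Cryptography Filter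

/-- **Discharge of the `QuantumAdvantage` catalogue fact `NaturalProofs`** (Razborov–Rudich 1997,
Thm. 4.1; Arora–Barak 2009, Thm. 23.1): by `naturalProofs_iff_pneNP` it is the discharged `PneNP`
entry `Literature.Barriers.PneNP.NaturalProofs_holds`. [cite: RazborovRudich1997, Thm. 4.1] [cite: AroraBarakCC2009, Thm. 23.1] -/
theorem NaturalProofs_holds : NaturalProofs :=
  naturalProofs_iff_pneNP.2 Literature.Barriers.PneNP.NaturalProofs_holds

/-- **No natural proof of `BQP ⊄ P/poly` if hard PRGs exist** — the thesis of route `CircuitLB`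
has no natural proof (tree notion `IsNaturalProofBQPNotPPoly`), conditional on `HardPRGExist`
only (the entry's `NaturalProofs.no_naturalProof_bqp_not_ppoly` with the barrier fact fed in).
[cite: RazborovRudich1997, Thm. 4.1] [cite: AroraBarakCC2009, Thm. 23.1] -/
theorem no_naturalProof_bqp_not_ppoly_of_hardPRG (hG : Literature.Barriers.PneNP.HardPRGExist) :
    ¬ ∃ P : CombinatorialProperty, IsNaturalProofBQPNotPPoly P :=
  NaturalProofs.no_naturalProof_bqp_not_ppoly NaturalProofs_holds hG

/-- **No natural proof of `FACT ∉ P/poly` if hard PRGs exist** — no natural property useful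
against `P/poly` contains the slices of `FACT` infinitely often (route `CircuitLB`, item
`ClbFactNotPpoly`), conditional on `HardPRGExist` only (the entry's
`NaturalProofs.no_naturalProof_fact` with the barrier fact fed in).
[cite: RazborovRudich1997, Thm. 4.1] [cite: AroraBarakCC2009, Thm. 23.1 and Ch. 23 introduction (PDF p. 586)] -/
theorem no_naturalProof_fact_of_hardPRG (hG : Literature.Barriers.PneNP.HardPRGExist) :
    ¬ ∃ Q : CombinatorialProperty, Literature.Barriers.PneNP.IsNaturalProof Q ∧
      ∃ᶠ n in atTop, (Literature.Computability.QuantumComplexity.FACT).sliceFn n ∈ Q n :=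
  NaturalProofs.no_naturalProof_fact NaturalProofs_holds hG

end Literature.Barriers.QuantumAdvantage

end
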